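import Summits.Schanuel.Schanuel.Theorems.ZilberEacDiagonalCriticalGeneric
import HarnessLib

/-!
# Generic pairs from a limit supply: `(v_k, T_k)` with `‖v_k‖ → ∞`, `T_k → T`, infinitely many `T`

Zilber's Exponential-Algebraic Closedness, case ladder (host summit Schanuel, cell `pub-schanuel`,
seat 2, gen 14).  The genericity input of THEOREM N₂ (`unprojectedDense_of_bddLinLin`) is a set
`PS ⊆ ℂ²` of limit pairs `(v, T)` on which no nonzero `Q ∈ ℂ[V, T]` vanishes.  Gen 13 supplied it by
explicit families (rotation `diagonalCritical_pairs_generic`, translation, super-polynomial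
convergence `pairs_generic_of_superpoly_limit`).  For the COUPLED limit system of the unequal-fibre
critical regime the pairs are not explicit; what the one-variable reduction
(`ZilberEacCriticalFibresSupply.exists_limitPairs_supply`) provides is softer:

  an infinite set `𝒯 ⊆ ℂ` such that every `T ∈ 𝒯` is approached, `T_k → T`, by pairs
  `(v_k, T_k) ∈ PS` with `‖v_k‖ → ∞`.

**`pairs_generic_of_limitSupply`**: this suffices.  Write `Q = Σ_{a ≤ A} q_a(T) V^a` with
`q_A ≠ 0`; along the pairs of `T`, `0 = Q(v_k, T_k)/v_k^A → q_A(T)`, so `q_A` vanishes on the infinite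
set `𝒯` — impossible.

HONEST FRAMING: a genericity lemma; `EC(3,2)` OPEN; NOT Schanuel's conjecture; EAC ⇏ SC.
-/

noncomputable section

open Complex MvPolynomial Filter Topology

set_option linter.dupNamespace false

namespace Summit.Schanuel.Schanuel.Theorems

section Generic

/-- `v_k^a / v_k^A → 0` for `a < A` when `‖v_k‖ → ∞`. [folklore] -/
theorem tendsto_pow_div_pow_of_norm_tendsto_atTop {v : ℕ → ℂ}
    (hv : Tendsto (fun k => ‖v k‖) atTop atTop) {a A : ℕ} (ha : a < A) :
    Tendsto (fun k => v k ^ a / v k ^ A) atTop (𝓝 0) := by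
  have hinv : Tendsto (fun k => (v k)⁻¹) atTop (𝓝 0) := by
    rw [tendsto_zero_iff_norm_tendsto_zero]
    have h := hv.inv_tendsto_atTop
    refine h.congr fun k => ?_
    simp [norm_inv]
  have hpow := hinv.pow (A - a)
  rw [zero_pow (Nat.sub_ne_zero_of_lt ha)] at hpow
  refine hpow.congr' ?_
  filter_upwards [hv.eventually_gt_atTop 0] with k hk
  have hvk : v k ≠ 0 := norm_pos_iff.1 hk
  rw [inv_pow, eq_div_iff (pow_ne_zero _ hvk), ← pow_sub_mul_pow _ ha.le,
    inv_mul_cancel_left₀ (pow_ne_zero _ hvk)]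

/-- **Generic pairs from a limit supply.**  `𝒯 ⊆ ℂ` infinite; for every `T ∈ 𝒯` a sequence of
pairs `(v_k, T_k)`, eventually in `PS`, with `‖v_k‖ → ∞` and `T_k → T`.  Then no nonzero
`Q ∈ ℂ[V, T]` vanishes on `PS`. (new) -/
theorem pairs_generic_of_limitSupply {𝒯 : Set ℂ} (h𝒯 : 𝒯.Infinite) {PS : Set (ℂ × ℂ)}
    (hsup : ∀ T ∈ 𝒯, ∃ vt : ℕ → ℂ × ℂ, (∀ᶠ k in atTop, vt k ∈ PS) ∧
      Tendsto (fun k => ‖(vt k).1‖) atTop atTop ∧ Tendsto (fun k => (vt k).2) atTop (𝓝 T))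
    (Q : MvPolynomial (Fin 2) ℂ) (hQ : Q ≠ 0) :
    ∃ vt ∈ PS, eval ![vt.1, vt.2] Q ≠ 0 := by
  classical
  by_contra hall
  push Not at hall
  -- the `V`-expansion of `Q` and its leading coefficient
  set Pq := finSuccEquiv ℂ 1 Q with hPq
  have hPq0 : Pq ≠ 0 := fun h => hQ ((finSuccEquiv ℂ 1).injective (by rw [← hPq, h, map_zero]))
  set A := Pq.natDegree with hA
  set L : Polynomial ℂ := uniqueAlgEquiv ℂ (Fin 1) (Pq.coeff A) with hL
  have hlead : Pq.coeff A ≠ 0 := by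
    rw [hA, Polynomial.coeff_natDegree]; exact Polynomial.leadingCoeff_ne_zero.2 hPq0
  have hL0 : L ≠ 0 := fun h => hlead ((uniqueAlgEquiv ℂ (Fin 1)).injective (by rw [← hL, h, map_zero]))
  -- a limit value off the roots of `L`
  obtain ⟨T, hT, hTroot⟩ := h𝒯.exists_notMem_finset L.roots.toFinset
  have hLT : L.eval T ≠ 0 := by
    intro h
    apply hTroot
    rw [Multiset.mem_toFinset]
    exact (Polynomial.mem_roots hL0).2 h
  obtain ⟨vt, hmem, hv, hTk⟩ := hsup T hT
  -- the coefficients converge, the normalised powers tend to `0`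
  have hcoef : ∀ a, Tendsto (fun k => eval (fun _ => (vt k).2) (Pq.coeff a)) atTop
      (𝓝 (eval (fun _ => T) (Pq.coeff a))) :=
    fun a => ((continuous_eval_fin_one (Pq.coeff a)).tendsto _).comp hTk
  have hterm : ∀ a ∈ Finset.range (A + 1), Tendsto (fun k =>
      eval (fun _ => (vt k).2) (Pq.coeff a) * ((vt k).1 ^ a / (vt k).1 ^ A))
      atTop (𝓝 (if a = A then eval (fun _ => T) (Pq.coeff A) else 0)) := by
    intro a ha
    have haA : a ≤ A := Nat.lt_succ_iff.1 (Finset.mem_range.1 ha)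
    rcases haA.lt_or_eq with hlt | heq
    · rw [if_neg hlt.ne]
      simpa using (hcoef a).mul (tendsto_pow_div_pow_of_norm_tendsto_atTop hv hlt)
    · rw [if_pos heq, heq]
      refine (hcoef A).congr' ?_
      filter_upwards [hv.eventually_gt_atTop 0] with k hk
      have hvk : (vt k).1 ≠ 0 := norm_pos_iff.1 hk
      rw [div_self (pow_ne_zero _ hvk), mul_one]
  have hsum := tendsto_finsetSum (Finset.range (A + 1)) hterm
  rw [Finset.sum_ite_eq' (Finset.range (A + 1)) A, if_pos (Finset.self_mem_range_succ A)] at hsum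
  -- but the normalised relation is eventually `0`
  have hzero : ∀ᶠ k in atTop, ∑ a ∈ Finset.range (A + 1),
      eval (fun _ => (vt k).2) (Pq.coeff a) * ((vt k).1 ^ a / (vt k).1 ^ A) = 0 := by
    filter_upwards [hmem] with k hk
    have hrel := hall (vt k) hk
    rw [eval_fin_two_eq_sum] at hrel
    have : ∑ a ∈ Finset.range (A + 1), eval (fun _ => (vt k).2) (Pq.coeff a) *
        ((vt k).1 ^ a / (vt k).1 ^ A) =
        (∑ a ∈ Finset.range (A + 1), eval (fun _ => (vt k).2) (Pq.coeff a) * (vt k).1 ^ a) /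
          (vt k).1 ^ A := by
      rw [Finset.sum_div]
      refine Finset.sum_congr rfl fun a _ => ?_
      ring
    rw [this, hrel, zero_div]
  have hlim0 : Tendsto (fun k => ∑ a ∈ Finset.range (A + 1),
      eval (fun _ => (vt k).2) (Pq.coeff a) * ((vt k).1 ^ a / (vt k).1 ^ A)) atTop (𝓝 0) :=
    tendsto_const_nhds.congr' (hzero.mono fun k hk => hk.symm)
  have huniq := tendsto_nhds_unique hsum hlim0
  apply hLT
  rw [eval_uniqueAlgEquiv_fin_one]
  exact huniq

end Generic

end Summit.Schanuel.Schanuel.Theorems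

end
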